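import Literature.NumberTheory.Automorphic.Liu2021.Prop413MultOneAsPrinted
import HarnessLib

/-!
# The `U(3)` oscillator-triple dictionary: the irreducible constituents of `H¹_{B,τ'}(A_∞, ℂ)` are the `ω(μ, ε, χ)` with
# `μ` of weight one and `ε` `μ`-admissible, each with a UNIQUE triple ([GR91] Thm 5.1.1 + p. 448 at `n = 3`, as [Liu 2021]
# Rem. 4.14 says; [Liu 2021] proof of Prop. 4.13, l. 2145, in general) — CLASSIFICATION and «admissible ⟺ occurs», AS PRINTED

Row **B3-12** of the cell hodgecm-mathlib's B-III DAG (B-plan2, 2026-08-28T00:26Z/01:05Z; consumer = fan-A line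
`a3-liu413`, predicate `ConstituentsAreTheta P τ'`, seat A-p10): the one step of [Liu2021, Rem. 4.14] («When `n = 3`,
Proposition 4.13 can be deduced from [GR91, Rog92]») that reads Gelbart–Rogawski's classification of the `H¹`-spectrum of
`U(3)` in Liu's labels `(μ, ε, χ)`.  Typed over the REAL objects the binders `h411`/`h413` quantify over — the datum
`P : Liu2021.Prop413Data F E` of `Prop413AsPrinted` (its triples `P.Triple` with REAL conjugate-symplectic `μ`, the carriers
`P.Eps`, `P.Chi`, the representations `P.rho μ _ ε χ = ω(μ, ε, χ)` of `G = 𝔾(𝔸_F^∞)`, and `(P.HB τ', P.rhoB τ')` =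
`H¹_{B,τ'}(A_∞, ℂ)`) — NOT over a second abstract dictionary; the Gelbart–Rogawski side is the tree's `GR91Spectrum`
(`WeilRepresentationsAPackets.lean`: `intro_h1_weil` p. 448, `thm511` p. 465, `weil_eq_iff` p. 447/461), cited by name.

## Sources, AS PRINTED

[Liu2021] Y. Liu, *Fourier–Jacobi cycles and arithmetic relative trace formula*, Camb. J. Math. **9** (2021) = arXiv:2102.11518,
TeX source `FJcycle.tex` (md5 `6db49a74122d…`, `l. NNNN` = its lines; the file read by `Prop413AsPrinted`):
* Prop. 4.13 (l. 2113–2119, `pr:endoscopy_general`; tree `Liu2021.Prop413AsPrinted`): «Suppose that `n ≥ 3`. Then for every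
  embedding `τ' : E → ℂ`, there is an isomorphism `H¹_{B,τ'}(A_∞, ℂ) ≃ ⊕_{(μ,ε,χ)} ω(μ,ε,χ)` of `ℂ[𝔾(𝔸_F^∞)]`-modules, where the
  direct sum is taken over all adèlic oscillator triples in which `μ` is of weight one and `ε` is `μ`-admissible.»
* its PROOF, l. 2131: «we have an isomorphism `H¹_{B,τ'}(A_∞, ℂ) ≃ ⊕_π m_disc(π) · H¹(𝔤, K_G; π_∞) ⊗ π^∞` of
  `ℂ[𝔾(𝔸_F^∞)]`-modules. We say that an irreducible admissible representation `π` of `G(𝔸)` contributes to the Albanese if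
  `m_disc(π) > 0` and `H¹(𝔤, K_G; π_∞) ≠ {0}`. We determine all such `π` together with the value `m_disc(π)`.»; l. 2145:
  «To summarize, we have shown that if an irreducible admissible representation `π` of `G(𝔸)` contributes to the Albanese,
  then `π^∞ ≃ ω(μ,ε,χ)` for a unique adèlic oscillator triple in which `μ` is of weight one and `ε` is `μ`-admissible, and
  `m_disc(π) = 1`. Conversely, for every such adèlic oscillator triple `(μ,ε,χ)`, there exists a pair `(W, π_W)`, unique up to
  isomorphism, such that if we denote by `π` an irreducible subrepresentation of `Θ^V_{(μ,ν),W}(π_W)`, then `ω(μ,ε,χ)` is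
  isomorphic to `π^∞` and `H¹(𝔤, K_G; π_∞) ≠ {0}`. Moreover, by the Rallis inner product formula, `Θ^V_{(μ,ν),W}(π_W)` is
  contained in `L²_disc(G)`. Thus, we may apply the above discussions to the representation `π` to conclude that the dimension
  of `H¹_{B,τ'}(A_∞, ℂ)[ω(μ,ε,χ)]` is `1`.» (the last sentence is the tree's `Prop413Data.MultOneAsPrinted`, CITED here, not
  restated);
* Rem. 4.14 (l. 2148–2150): «When `n = 3`, Proposition 4.13 can be deduced from [GR91, Rog92].» ([Rog92] = J. Rogawski,
  *Analytic expression for the number of points mod `p`*, in *The zeta functions of Picard modular surfaces*, CRM 1992 —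
  Liu's bibliography l. 6845; not held, acq-09316/acq-13595 open);
* the LOCAL identification of the labels, App. D proof of Lem. D.1 (l. 5241, 5255): Liu's `ω(μ, ε, χ)` of `U(V)(F_v)` is
  described «See for example [GR90]*2.6» (split `v`) and «(3) … is known when `n = 3` by [GR90]*Proposition 5.1.4» (`E_v` a
  field) — i.e. at `n = 3` Liu's local oscillator representation `ω(μ_v, ε_v, χ_v)` IS Gelbart–Rogawski's local Weil
  representation, with `μ_v ↔ γ_v` (the splitting character), the class `ε_v ∈ E_v^{−×}/Nm` ↔ the additive character `ψ_v`
  modulo norms ([GR91] §3.2 Remark (3) p. 458 «`ω(ψ, γ)` depends only on `ψ` modulo norms from `E`»; Liu l. 5217 footnote),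
  `χ_v ↔ χ_v` (central character).
[GelbartRogawski1991] S. Gelbart, J. Rogawski, Invent. Math. **105** (1991) 445–472 (held; tree `GR91Spectrum`): Introduction
p. 448 L30–33 «For `U = U(3)`, the results of this paper, together with the characterization of representations `π` with
non-trivial `H¹` in [R], show that every discrete `π` with `H¹(Lie(U), K, π_∞) ≠ 0` is a Weil representation» (`intro_h1_weil`);
Thm 5.1.1 p. 465 (`thm511`: discrete `π` is a Weil representation `ω(γ, ψ, χ)` iff `π ∈ Π(ρ)`, with (5.1.1)); p. 447 L6–8 / p. 461
(`weil_eq_iff`: `ω(γ,ψ,χ) ≅ ω(γ′,ψ′,χ′)` iff `(γ′, ψ′, χ′) = (γ, ψ^δ, χ)`, `δ ∈ N_{E/F}(E^*)` — the UNIQUENESS of the label);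
p. 446 L9–11 «[R₂, Theorem 1.1] … an element `π = ⊗π_v` of `Π(ρ)` is discrete … if and only if `(−1)^{|X|} = ε(½, φ)`» (the
multiplicity rule behind «`ε` `μ`-admissible ⟺ `ω(μ,ε,χ)` occurs», with Rogawski's multiplicity one for `U(3)`, [Rogawski1990]
Thm 13.3.1).  SCOPE CAVEAT (from `WeilRepresentationsAPackets`): [GR91]'s GLOBAL statements are printed for the QUASI-SPLIT
`U(3)`; Liu's Rem. 4.14 asserts the deduction for his `𝔾 = U(𝕍)` without that restriction, and Liu's own proof (l. 2121–2146,
every `n ≥ 2`) does not use [GR91].  The records below therefore carry BOTH citations: they are PROVED in print by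
[Liu2021] (proof of Prop. 4.13) and, at `n = 3`, are the reading of [GR91] that Rem. 4.14 names.

## What is typed (predicates on the consumer's datum `P`; NOTHING IS ASSERTED; no proof of the cited theorems)

* `OccursInH1 P τ' σ` — «`π` contributes to the Albanese» read on the finite part (READING O: by the display l. 2131, `π`
  contributes iff `π^∞` admits a non-zero `𝔾(𝔸_F^∞)`-intertwiner into `H¹_{B,τ'}(A_∞, ℂ)`; for irreducible `π^∞` = is a
  constituent): there is a non-zero intertwining map `σ → (P.HB τ', P.rhoB τ')` (Mathlib `Representation.IntertwiningMap`, the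
  currency of `MultOneAsPrinted`).
* `IsIsoToOmega P σ t` — «`π^∞ ≃ ω(μ,ε,χ)`»: a `G`-equivariant `ℂ`-linear equivalence onto `ω_t` (READING R6 of
  `Thm418AsPrinted`; the shape of `ConstituentsAreTheta`).
* **`oscillatorTriple_dictionary P`** (B3-12 (a), CLASSIFICATION with uniqueness of the label): for `P.n = 3`, every
  IRREDUCIBLE `σ` occurring in `H¹_{B,τ'}(A_∞, ℂ)` is `≅ ω_t` for some admissible weight-one triple `t`, and the triple
  `t : P.Triple` with `σ ≅ ω_t` is unique.
* **`muAdmissible_iff_multiplicity_one P`** (B3-12 (c), «`ε` is `μ`-admissible ⟺ `ω(μ,ε,χ)` occurs»): for `P.n = 3` and a triple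
  `t` with `μ` of weight one, `ω_t` occurs in `H¹_{B,τ'}(A_∞, ℂ)` iff `ε` is `μ`-admissible — (⇒) is the «`ε` is `μ`-admissible»
  conclusion of l. 2145 with the uniqueness of the triple, (⇐) its «Conversely» clause; at `n = 3` it is [R₂ Thm 1.1]'s sign
  rule in Liu's labels (B3-DAG rows B3-08/B3-12).  The MULTIPLICITY VALUE `1` for admissible `t` is the tree's
  `Liu2021.Prop413Data.MultOneAsPrinted` (l. 2145, last sentence) — cited, and COMBINED below (`rank_eq_one_iff_isAdmissible`).
* kernel: `occursInH1_rhoAt_of_multOne` (`MultOneAsPrinted ⟹` every admissible `ω_t` occurs), the apply-shapes of (a), and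
  `rank_eq_one_iff_isAdmissible` ((c) + `MultOneAsPrinted`: for weight-one `t`, `dim Hom_G(ω_t, H¹_{B,τ'}) = 1 ⟺ ε admissible`,
  and `= 0`-or-`1`).

«`μ` of weight one ⟺ `π_{τ′}` ∈ {J^±}`» (B3-DAG (b), the archimedean half) is NOT a clause here: it is [Liu2021] Lem. D.2 (2)
(tree `Liu2021.LemD2.LemD2_2AsPrinted`, file `Liu2021/LemD2AsPrinted.lean`) and lives on the archimedean component, which the
datum `P` (finite-adèlic) does not carry.  NOT here either: the Krull–Schmidt matching of an arbitrary irreducible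
decomposition (`ConstituentsAreTheta`, A-p10's glue), Prop. 4.13 itself, any GR91 object.

## References
* [Liu2021] Prop. 4.13 (l. 2113–2119) with proof l. 2121–2146 (esp. l. 2131, l. 2145); Rem. 4.14 (l. 2148–2150); Def. 4.11–4.12
  (l. 2083–2110); App. D proof of Lem. D.1 (l. 5241, 5255).
* [GelbartRogawski1991] Introduction pp. 446–448; Thm 5.1.1 p. 465; §3.2 Remark (3) p. 458; Remark p. 461.
* [Rogawski1990] J. Rogawski, Ann. of Math. Stud. 123, Thm 13.3.1 (multiplicity one), §13.3.
* Tree: `Liu2021.Prop413AsPrinted`, `Liu2021.Prop413Data.MultOneAsPrinted` (+ `.rank_intertwiningMap_le_one`),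
  `GelbartRogawski1991.GR91Spectrum.intro_h1_weil/thm511/weil_eq_iff`, `Liu2021.LemD1_3AsPrinted`, `Liu2021.LemD2.LemD2_2AsPrinted`.
-/

noncomputable section

open NumberField

namespace Literature.NumberTheory.GelbartRogawski1991

open Literature.NumberTheory.Automorphic Literature.NumberTheory.Automorphic.Liu2021

variable {F E : Type} [Field F] [NumberField F] [IsTotallyReal F] [Field E] [NumberField E] [Algebra F E]
  [IsTotallyComplex E] [Algebra.IsQuadraticExtension F E]

namespace OscillatorTripleDictionary

/-- `ω_t = ω(μ, ε, χ)` with its `𝔾(𝔸_F^∞)`-action for an ARBITRARY adèlic oscillator triple `t = (μ, ε, χ)` of the datum `P`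
(for admissible weight-one `t` this is `P.rhoAt`). [cite: Liu2021, Def. 4.11 (l. 2092–2096)] -/
abbrev rhoTriple (P : Prop413Data F E) (t : P.Triple) :
    Representation ℂ P.G (P.omega t.μ t.isConjugateSymplectic t.ε t.χ) :=
  P.rho t.μ t.isConjugateSymplectic t.ε t.χ

/-- `rhoTriple` at an admissible weight-one triple is `P.rhoAt`. [cite: Liu2021, Def. 4.11 and Prop. 4.13] -/
theorem rhoTriple_val (P : Prop413Data F E) (t : P.AdmTriple) : rhoTriple P t.1 = P.rhoAt t := rfl

/-- **«`π` contributes to the Albanese»**, read on the finite part `σ = π^∞` (READING O): `σ` admits a NON-ZERO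
`𝔾(𝔸_F^∞)`-intertwining map into `H¹_{B,τ'}(A_∞, ℂ) = (P.HB τ', P.rhoB τ')` — for irreducible `σ`: `σ` is a constituent.
[cite: Liu2021, proof of Prop. 4.13, l. 2131] -/
def OccursInH1 (P : Prop413Data F E) (τ' : E →+* ℂ) {W : Type} [AddCommGroup W] [Module ℂ W]
    (σ : Representation ℂ P.G W) : Prop :=
  ∃ j : Representation.IntertwiningMap σ (P.rhoB τ'), j ≠ 0

/-- unfolding of `OccursInH1`. [cite: Liu2021, proof of Prop. 4.13, l. 2131] -/
theorem occursInH1_iff (P : Prop413Data F E) (τ' : E →+* ℂ) {W : Type} [AddCommGroup W] [Module ℂ W]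
    (σ : Representation ℂ P.G W) :
    OccursInH1 P τ' σ ↔ ∃ j : Representation.IntertwiningMap σ (P.rhoB τ'), j ≠ 0 :=
  Iff.rfl

/-- **«`π^∞ ≃ ω(μ, ε, χ)`»**: a `𝔾(𝔸_F^∞)`-equivariant `ℂ`-linear equivalence from `σ` onto `ω_t` (READING R6 of
`Thm418AsPrinted`: isomorphism of `ℂ[G]`-modules = equivariant linear equivalence; the shape of the consumer
`ConstituentsAreTheta`). [cite: Liu2021, proof of Prop. 4.13, l. 2145] -/
def IsIsoToOmega (P : Prop413Data F E) {W : Type} [AddCommGroup W] [Module ℂ W] (σ : Representation ℂ P.G W)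
    (t : P.Triple) : Prop :=
  ∃ f : W ≃ₗ[ℂ] P.omega t.μ t.isConjugateSymplectic t.ε t.χ, ∀ (g : P.G) (w : W), f (σ g w) = rhoTriple P t g (f w)

/-- unfolding of `IsIsoToOmega`. [cite: Liu2021, proof of Prop. 4.13, l. 2145] -/
theorem isIsoToOmega_iff (P : Prop413Data F E) {W : Type} [AddCommGroup W] [Module ℂ W] (σ : Representation ℂ P.G W)
    (t : P.Triple) :
    IsIsoToOmega P σ t ↔
      ∃ f : W ≃ₗ[ℂ] P.omega t.μ t.isConjugateSymplectic t.ε t.χ, ∀ (g : P.G) (w : W), f (σ g w) = rhoTriple P t g (f w) :=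
  Iff.rfl

end OscillatorTripleDictionary

open OscillatorTripleDictionary

/-- **B3-12 (a) — THE CLASSIFICATION, in Liu's labels, for `U(3)`** (`P.n = 3`).  [GR91, Introduction p. 448 L30–33 with
Thm 5.1.1 p. 465]: «every discrete `π` with `H¹(Lie(U), K, π_∞) ≠ 0` is a Weil representation» `ω(γ, ψ, χ)`, the label being
unique up to `ψ ↦ ψ^δ`, `δ ∈ N_{E/F}(E^*)` (p. 447 L6–8) — READ through the dictionary `(γ, ψ mod N_{E/F}, χ) ↔ (μ, ε, χ)`
([Liu2021] App. D proof of Lem. D.1, l. 5241/5255: at `n = 3` Liu's `ω(μ_v, ε_v, χ_v)` is [GR90]'s local Weil representation)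
as [Liu2021, Rem. 4.14] says, and PROVED for every `n` in [Liu2021, proof of Prop. 4.13, l. 2145]: «if an irreducible admissible
representation `π` of `G(𝔸)` contributes to the Albanese, then `π^∞ ≃ ω(μ,ε,χ)` for a unique adèlic oscillator triple in which
`μ` is of weight one and `ε` is `μ`-admissible».  TYPED: for `P.n = 3`, every `τ'`, every IRREDUCIBLE representation `σ` of
`𝔾(𝔸_F^∞)` that occurs in `H¹_{B,τ'}(A_∞, ℂ)` (`OccursInH1`) is `≅ ω_t` (`IsIsoToOmega`) for some admissible weight-one
triple `t : P.AdmTriple`, and the triple `t : P.Triple` with `σ ≅ ω_t` is UNIQUE.  A predicate on the consumer's `P`; the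
`n = 3` scope is [GR91]'s `U(3)` (for `n ≥ 3` the same sentence is Liu's l. 2145).
[cite: GelbartRogawski1991, Introduction p. 448 L30–33; Thm 5.1.1 p. 465; p. 447 L6–8]
[cite: Liu2021, Rem. 4.14 (l. 2148); proof of Prop. 4.13, l. 2145; App. D proof of Lem. D.1, l. 5255] -/
def oscillatorTriple_dictionary (P : Prop413Data F E) : Prop :=
  P.n = 3 → ∀ (τ' : E →+* ℂ) (W : Type) [AddCommGroup W] [Module ℂ W] (σ : Representation ℂ P.G W),
    σ.IsIrreducible → OccursInH1 P τ' σ →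
      (∃ t : P.AdmTriple, IsIsoToOmega P σ t.1) ∧
        ∀ t₁ t₂ : P.Triple, IsIsoToOmega P σ t₁ → IsIsoToOmega P σ t₂ → t₁ = t₂

/-- **B3-12 (c) — «`ε` is `μ`-admissible ⟺ `ω(μ, ε, χ)` occurs in `H¹_{B,τ'}(A_∞, ℂ)`», for `U(3)`** (`P.n = 3`) and a triple
`t = (μ, ε, χ)` with `μ` OF WEIGHT ONE.  (⇒): an occurring `ω_t` is `≅ ω_{t'}` with `t'` admissible and the triple is unique,
so `ε` is `μ`-admissible — [Liu2021, l. 2145, first sentence]; (⇐): «Conversely, for every such adèlic oscillator triple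
`(μ,ε,χ)`, there exists a pair `(W, π_W)` … `ω(μ,ε,χ)` is isomorphic to `π^∞` and `H¹(𝔤, K_G; π_∞) ≠ {0}` … `Θ^V_{(μ,ν),W}(π_W)`
is contained in `L²_disc(G)`» — [Liu2021, l. 2145].  At `n = 3` this is, per [Liu2021, Rem. 4.14], the multiplicity rule
«[R₂, Theorem 1.1] … `π ∈ Π(ρ)` is discrete iff `(−1)^{|X|} = ε(½, φ)`» ([GR91] p. 446 L9–11, with Thm 5.1.1) read in Liu's
labels (the sign condition of Def. 4.12 ⟺ the root-number condition; B3-DAG rows B3-08/B3-12).  The VALUE of the multiplicity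
(`= 1`) is the tree's `Liu2021.Prop413Data.MultOneAsPrinted`, not restated; see `rank_eq_one_iff_isAdmissible`.
[cite: Liu2021, proof of Prop. 4.13, l. 2145; Rem. 4.14 (l. 2148); Def. 4.12 (l. 2102–2108)]
[cite: GelbartRogawski1991, Introduction p. 446 L9–11; Thm 5.1.1 p. 465] -/
def muAdmissible_iff_multiplicity_one (P : Prop413Data F E) : Prop :=
  P.n = 3 → ∀ (τ' : E →+* ℂ) (t : P.Triple), t.HasWeightOne → (OccursInH1 P τ' (rhoTriple P t) ↔ t.IsAdmissible)

/-! ## Kernel: the shapes consumed by `a3-liu413` / A-p10, and the combination with `MultOneAsPrinted` -/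

namespace OscillatorTripleDictionary

variable {P : Prop413Data F E}

/-- (a), existence: an irreducible constituent of `H¹_{B,τ'}(A_∞, ℂ)` is `≅ ω_t` for some admissible weight-one `t`.
[cite: Liu2021, proof of Prop. 4.13, l. 2145] [cite: GelbartRogawski1991, Introduction p. 448 L30–33] -/
theorem exists_admTriple (h : oscillatorTriple_dictionary P) (hn : P.n = 3) (τ' : E →+* ℂ) {W : Type} [AddCommGroup W]
    [Module ℂ W] (σ : Representation ℂ P.G W) (hirr : σ.IsIrreducible) (hocc : OccursInH1 P τ' σ) :
    ∃ t : P.AdmTriple, ∃ f : W ≃ₗ[ℂ] P.omegaAt t, ∀ (g : P.G) (w : W), f (σ g w) = P.rhoAt t g (f w) :=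
  (h hn τ' W σ hirr hocc).1

/-- (a), uniqueness of the label: `σ ≅ ω_{t₁}` and `σ ≅ ω_{t₂}` force `t₁ = t₂`.
[cite: Liu2021, proof of Prop. 4.13, l. 2145 («for a unique adèlic oscillator triple»)] [cite: GelbartRogawski1991, p. 447 L6–8] -/
theorem triple_unique (h : oscillatorTriple_dictionary P) (hn : P.n = 3) (τ' : E →+* ℂ) {W : Type} [AddCommGroup W]
    [Module ℂ W] (σ : Representation ℂ P.G W) (hirr : σ.IsIrreducible) (hocc : OccursInH1 P τ' σ) {t₁ t₂ : P.Triple}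
    (h₁ : IsIsoToOmega P σ t₁) (h₂ : IsIsoToOmega P σ t₂) : t₁ = t₂ :=
  (h hn τ' W σ hirr hocc).2 t₁ t₂ h₁ h₂

/-- (a), uniqueness among admissible weight-one triples (the index type of Prop. 4.13).
[cite: Liu2021, proof of Prop. 4.13, l. 2145] -/
theorem admTriple_unique (h : oscillatorTriple_dictionary P) (hn : P.n = 3) (τ' : E →+* ℂ) {W : Type} [AddCommGroup W]
    [Module ℂ W] (σ : Representation ℂ P.G W) (hirr : σ.IsIrreducible) (hocc : OccursInH1 P τ' σ) {t₁ t₂ : P.AdmTriple}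
    (h₁ : IsIsoToOmega P σ t₁.1) (h₂ : IsIsoToOmega P σ t₂.1) : t₁ = t₂ :=
  Subtype.ext (triple_unique h hn τ' σ hirr hocc h₁ h₂)

/-- `MultOneAsPrinted ⟹` every admissible weight-one `ω_t` OCCURS in `H¹_{B,τ'}(A_∞, ℂ)` (a rank-`1` space of intertwiners has a
non-zero element) — the (⇐) direction of (c) is already in the tree for `n ≥ 3`. [cite: Liu2021, proof of Prop. 4.13, l. 2145] -/
theorem occursInH1_rhoAt_of_multOne (hm : P.MultOneAsPrinted) (hn : 3 ≤ P.n) (τ' : E →+* ℂ) (t : P.AdmTriple) :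
    OccursInH1 P τ' (P.rhoAt t) := by
  have hr : Module.rank ℂ (Representation.IntertwiningMap (P.rhoAt t) (P.rhoB τ')) = 1 := hm hn τ' t
  have hnt : Nontrivial (Representation.IntertwiningMap (P.rhoAt t) (P.rhoB τ')) := by
    rw [← rank_pos_iff_nontrivial (R := ℂ), hr]
    exact zero_lt_one
  exact exists_ne 0

/-- (c), (⇒): for a weight-one triple, if `ω_t` occurs then `ε` is `μ`-admissible.
[cite: Liu2021, proof of Prop. 4.13, l. 2145; Def. 4.12] [cite: GelbartRogawski1991, p. 446 L9–11] -/
theorem isAdmissible_of_occursInH1 (h : muAdmissible_iff_multiplicity_one P) (hn : P.n = 3) (τ' : E →+* ℂ) (t : P.Triple)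
    (hw : t.HasWeightOne) (hocc : OccursInH1 P τ' (rhoTriple P t)) : t.IsAdmissible :=
  (h hn τ' t hw).1 hocc

/-- (c), (⇐) together with `MultOneAsPrinted`: for a triple with `μ` of weight one, `P.n = 3`,
`dim_ℂ Hom_{ℂ[G]}(ω_t, H¹_{B,τ'}(A_∞, ℂ)) = 1 ⟺ ε is μ-admissible` — «`μ`-admissible ⟺ multiplicity one».
[cite: Liu2021, proof of Prop. 4.13, l. 2145; Rem. 4.14] [cite: GelbartRogawski1991, p. 446 L9–11; Thm 5.1.1 p. 465] -/
theorem rank_eq_one_iff_isAdmissible (h : muAdmissible_iff_multiplicity_one P) (hm : P.MultOneAsPrinted) (hn : P.n = 3)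
    (τ' : E →+* ℂ) (t : P.Triple) (hw : t.HasWeightOne) :
    Module.rank ℂ (Representation.IntertwiningMap (rhoTriple P t) (P.rhoB τ')) = 1 ↔ t.IsAdmissible := by
  constructor
  · intro hr
    have hnt : Nontrivial (Representation.IntertwiningMap (rhoTriple P t) (P.rhoB τ')) := by
      rw [← rank_pos_iff_nontrivial (R := ℂ), hr]
      exact zero_lt_one
    exact (h hn τ' t hw).1 (exists_ne 0)
  · intro ha
    exact hm (by omega) τ' ⟨t, hw, ha⟩

/-- (c) + `MultOneAsPrinted`, the dichotomy: for a weight-one triple the space of intertwiners `ω_t → H¹_{B,τ'}(A_∞, ℂ)` is `0`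
(`ε` not `μ`-admissible) or of rank `1` (`ε` `μ`-admissible). [cite: Liu2021, proof of Prop. 4.13, l. 2145; Rem. 4.14] -/
theorem subsingleton_or_rank_eq_one (h : muAdmissible_iff_multiplicity_one P) (hm : P.MultOneAsPrinted) (hn : P.n = 3)
    (τ' : E →+* ℂ) (t : P.Triple) (hw : t.HasWeightOne) :
    Subsingleton (Representation.IntertwiningMap (rhoTriple P t) (P.rhoB τ')) ∨
      Module.rank ℂ (Representation.IntertwiningMap (rhoTriple P t) (P.rhoB τ')) = 1 := by
  by_cases ha : t.IsAdmissible
  · exact Or.inr ((rank_eq_one_iff_isAdmissible h hm hn τ' t hw).2 ha)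
  · refine Or.inl (subsingleton_iff.2 fun j₁ j₂ => ?_)
    by_contra hne
    have : OccursInH1 P τ' (rhoTriple P t) := by
      by_cases h₁ : j₁ = 0
      · exact ⟨j₂, fun h₂ => hne (by rw [h₁, h₂])⟩
      · exact ⟨j₁, h₁⟩
    exact ha ((h hn τ' t hw).1 this)

end OscillatorTripleDictionary

end Literature.NumberTheory.GelbartRogawski1991

end
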